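import Literature.NumberTheory.Li1992.RallisInnerProductThetaLift
import Literature.NumberTheory.Automorphic.AdelicSchwartzBruhatTensor
import HarnessLib

/-!
# The `L²(X(A))` pairing and the Weil matrix coefficient on FACTORIZABLE Schwartz–Bruhat functions:
# the archimedean / finite split of [Li1992, (27)], and the archimedean factor at an eigenvector

J.-S. Li, *Non-vanishing theorems for the cohomology of certain arithmetic quotients*, J. reine angew. Math. **428**
(1992) 177–217 [Li1992], Theorem 2.1, second display (27) p. 184: «if `φ = ⊗ φ_v`, `f = ⊗ f_v` … then the right hand
side of (26) is the product over all places `v` of the local integrals `∫_{G'_v} ⟨ω_v(h_v)φ_v, φ_v⟩ ⟨π_v(h_v) f_v, f_v⟩ dh_v`»;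
J. Tate, *Fourier analysis in number fields and Hecke's zeta-functions* (1967), §3.3 («`dx = ∏ dx_v`») [TateThesis1967].

Topic `NumberTheory/Li1992`; namespace `Literature.NumberTheory.Li1992`.  KERNEL file: THEOREMS ONLY, proved from the tree's
`schwartzPairing` (`RallisInnerProductThetaLift.lean` §2: `⟨Φ₁, Φ₂⟩ = ∫ Φ₁ \overline{Φ₂} dν_X` on `𝒮(𝔸_Fⁿ)`), the tensor
structure `𝒮(𝔸_F^ι) = 𝓢((F ⊗ ℝ)^ι) ⊗ 𝒮((𝔸_{F,f})^ι)` (`AdelicSchwartzBruhatTensor`: `piSchwartzBruhatEquiv`, `adelicRep ω_∞ ω_f`,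
`adelicRep_apply_tmul`) and the product structure of Haar measure on `𝔸_F^ι` (`AdelicPiSchwartzBruhatFourier`:
`piAdeleSplit`, `exists_haar_eq_smul_map_prod`, `integral_eq_smul_integral_prod`).  Nothing is cited as a hypothesis; this is
the FIRST (archimedean / finite) step of the factorisation (27), the step the non-vanishing half of [Liu2021, proof of
Prop. 4.13, l. 2145] uses with the harmonic archimedean vector of [Liu2021, Lem. D.2 (2)] as `Φ_∞`:

* §1 `schwartzPairing_tmul_tmul` — for `ν_X = c · split_*(μ_∞ ⊗ μ_f)`:
  **`⟨Φ_∞ ⊗ Φ_f, Ψ_∞ ⊗ Ψ_f⟩ = c · ⟨Φ_∞, Ψ_∞⟩_∞ · ⟨Φ_f, Ψ_f⟩_f`** (Fubini on `(F ⊗ ℝ)^ι × (𝔸_{F,f})^ι`);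
* §2 `schwartzPairing_adelicRep_tmul` — for the adelic representation `ω = ω_∞ ⊗ ω_f` of `G_∞ × G_f`
  ([Weil1964, n° 37–39]: the global Weil representation is the product of the local ones) the Weil matrix coefficient of
  factorizable vectors factorises: **`⟨ω(g_∞, g_f)(Φ_∞ ⊗ Φ_f), Ψ_∞ ⊗ Ψ_f⟩ = c · ⟨ω_∞(g_∞)Φ_∞, Ψ_∞⟩_∞ · ⟨ω_f(g_f)Φ_f, Ψ_f⟩_f`**,
  and so does its integral against a product character over a product measure
  (`integral_schwartzPairing_adelicRep_tmul_mul`): print's (27) with the places grouped as `∞ ⊔ f`;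
* §3 `integral_archCoeff_mul_conj_of_eigen` — if `Φ_∞` is an `ω_∞`-EIGENVECTOR with unitary eigencharacter `χ_∞` of a
  group `G_∞` of finite measure (the harmonic vector under the compact `U(W)(F ⊗ ℝ)`), then
  **`∫_{G_∞} ⟨ω_∞(a)Φ_∞, Ψ_∞⟩ \overline{χ_∞(a)} dμ_∞ = μ_∞(G_∞) · ⟨Φ_∞, Ψ_∞⟩_∞`**; whence
  (`integral_coeff_tmul_mul_conj_of_eigen`) the `χ̄_∞ ⊗ χ̄_f`-Fourier coefficient of the global matrix coefficient is
  `c · μ_∞(G_∞) · ⟨Φ_∞, Ψ_∞⟩_∞` times the FINITE Fourier coefficient `∫_{G_f} ⟨ω_f(b)Φ_f, Ψ_f⟩ \overline{χ_f(b)} dμ_f`, and is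
  non-zero iff the latter is (`…_ne_zero_iff`) — the input of `RallisInnerProductCharacterLift`'s polarised criterion is
  thereby reduced to the finite places.

## Mathlib / tree search
`schwartzPairing` — only `Li1992/RallisInnerProductThetaLift.lean` (definition) and `…CharacterLift.lean` (consumer);
factorizable integrals on `𝔸^ι`: `AdelicPiSchwartzBruhatFourier` (`integral_eq_smul_integral_prod`,
`IsFactorizablePiSchwartzBruhat.*`), `AdelicPiSchwartzBruhatPlancherel`; no pairing-of-pure-tensors statement.  Mathlib:
`MeasureTheory.integral_prod_mul`, `integral_const_mul`, `integral_const`, `smul_apply`.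

## References
* [Li1992] J.-S. Li, J. reine angew. Math. 428 (1992), Thm 2.1 (26)–(27) p. 184.
* [TateThesis1967] J. Tate, in Cassels–Fröhlich, *Algebraic Number Theory* (1967), Ch. XV §3.3, §4.2.
* [Weil1964] A. Weil, Acta Math. 111 (1964), Chap. III n° 37–39.
* [Liu2021] Y. Liu, Camb. J. Math. 9 (2021), proof of Prop. 4.13 (l. 2145); App. D Lem. D.2 (2).
-/

set_option autoImplicit false

noncomputable section

open _root_.MeasureTheory NumberField NumberField.mixedEmbedding IsDedekindDomain
open scoped ComplexConjugate TensorProduct SchwartzMap NNReal Classical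
open Literature.NumberTheory.Automorphic

namespace Literature.NumberTheory.Li1992

variable (F : Type) [Field F] [NumberField F] (ι : Type) [Fintype ι]
  [MeasurableSpace (AdeleRing (𝓞 F) F)] [BorelSpace (AdeleRing (𝓞 F) F)]
  [MeasurableSpace (FiniteAdeleRing (𝓞 F) F)] [BorelSpace (FiniteAdeleRing (𝓞 F) F)]
  {νX : Measure (ι → AdeleRing (𝓞 F) F)} {μE : Measure (ι → mixedSpace F)}
  {μf : Measure (ι → FiniteAdeleRing (𝓞 F) F)} {c : ℝ≥0}

/-! ## §1 The pairing of factorizable functions -/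

/-- **`⟨Φ_∞ ⊗ Φ_f, Ψ_∞ ⊗ Ψ_f⟩ = c · ⟨Φ_∞, Ψ_∞⟩_∞ · ⟨Φ_f, Ψ_f⟩_f`** for `ν_X = c · split_*(μ_∞ ⊗ μ_f)` (every additive Haar
measure on `𝔸_F^ι` has this form, `exists_haar_eq_smul_map_prod`): the `L²(X(A))` pairing of factorizable Schwartz–Bruhat
functions is the product of the archimedean and the finite pairings. [cite: Li1992, Thm 2.1 (27) p. 184]
[cite: TateThesis1967, §3.3] -/
theorem schwartzPairing_tmul_tmul [SFinite μE] [SFinite μf] (hν : νX = c • (μE.prod μf).map (piAdeleSplit F ι))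
    (Φinf Ψinf : 𝓢((ι → mixedSpace F), ℂ)) (Φfin Ψfin : FinSB F ι) :
    schwartzPairing F ι νX (piSchwartzBruhatEquiv F ι (Φinf ⊗ₜ Φfin)) (piSchwartzBruhatEquiv F ι (Ψinf ⊗ₜ Ψfin)) =
      (c : ℂ) * ((∫ x, Φinf x * conj (Ψinf x) ∂μE) *
        ∫ y, (Φfin : (ι → FiniteAdeleRing (𝓞 F) F) → ℂ) y * conj ((Ψfin : (ι → FiniteAdeleRing (𝓞 F) F) → ℂ) y) ∂μf) := by
  rw [schwartzPairing_apply, coe_piSchwartzBruhatEquiv_tmul, coe_piSchwartzBruhatEquiv_tmul,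
    integral_eq_smul_integral_prod hν]
  simp only [piArch_piAdeleSplit, piFinite_piAdeleSplit, map_mul]
  rw [← integral_prod_mul, Complex.real_smul]
  congr 1
  refine integral_congr_ae (Filter.Eventually.of_forall fun p => ?_)
  simp only
  ring

/-! ## §2 The Weil matrix coefficient of factorizable vectors for `ω = ω_∞ ⊗ ω_f` -/

variable {Ginf Gfin : Type*} [Monoid Ginf] [Monoid Gfin]
  (ωinf : Representation ℂ Ginf 𝓢((ι → mixedSpace F), ℂ)) (ωfin : Representation ℂ Gfin (FinSB F ι))

/-- **`⟨ω(g_∞, g_f)(Φ_∞ ⊗ Φ_f), Ψ_∞ ⊗ Ψ_f⟩ = c · ⟨ω_∞(g_∞)Φ_∞, Ψ_∞⟩_∞ · ⟨ω_f(g_f)Φ_f, Ψ_f⟩_f`**: the matrix coefficient of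
the product representation `adelicRep ω_∞ ω_f` at factorizable vectors is the product of the local (archimedean / finite)
matrix coefficients. [cite: Li1992, Thm 2.1 (27) p. 184] [cite: Weil1964, Chap. III n° 37–39] -/
theorem schwartzPairing_adelicRep_tmul [SFinite μE] [SFinite μf] (hν : νX = c • (μE.prod μf).map (piAdeleSplit F ι))
    (g : Ginf × Gfin) (Φinf Ψinf : 𝓢((ι → mixedSpace F), ℂ)) (Φfin Ψfin : FinSB F ι) :
    schwartzPairing F ι νX (adelicRep ωinf ωfin g (piSchwartzBruhatEquiv F ι (Φinf ⊗ₜ Φfin)))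
        (piSchwartzBruhatEquiv F ι (Ψinf ⊗ₜ Ψfin)) =
      (c : ℂ) * ((∫ x, ωinf g.1 Φinf x * conj (Ψinf x) ∂μE) *
        ∫ y, ((ωfin g.2 Φfin : FinSB F ι) : (ι → FiniteAdeleRing (𝓞 F) F) → ℂ) y *
          conj ((Ψfin : (ι → FiniteAdeleRing (𝓞 F) F) → ℂ) y) ∂μf) := by
  rw [adelicRep_apply_tmul, schwartzPairing_tmul_tmul F ι hν]

/-- **(27), places grouped as `∞ ⊔ f`**: the integral over `G_∞ × G_f` (product measure) of the global matrix coefficient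
of factorizable vectors against a product weight `a_∞(g_∞) · a_f(g_f)` (e.g. `\overline{χ_∞} ⊗ \overline{χ_f}` for a
character `χ = χ_∞ ⊗ χ_f`) is `c` times the product of the archimedean and the finite integrals (Fubini; by Mathlib's
convention both sides are `0` together when an inner integral diverges). [cite: Li1992, Thm 2.1 (27) p. 184] -/
theorem integral_schwartzPairing_adelicRep_tmul_mul [SFinite μE] [SFinite μf]
    (hν : νX = c • (μE.prod μf).map (piAdeleSplit F ι))
    [MeasurableSpace Ginf] [MeasurableSpace Gfin] (μinf : Measure Ginf) (μfin : Measure Gfin) [SFinite μinf]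
    [SFinite μfin] (ainf : Ginf → ℂ) (afin : Gfin → ℂ)
    (Φinf Ψinf : 𝓢((ι → mixedSpace F), ℂ)) (Φfin Ψfin : FinSB F ι) :
    ∫ g, schwartzPairing F ι νX (adelicRep ωinf ωfin g (piSchwartzBruhatEquiv F ι (Φinf ⊗ₜ Φfin)))
        (piSchwartzBruhatEquiv F ι (Ψinf ⊗ₜ Ψfin)) * (ainf g.1 * afin g.2) ∂(μinf.prod μfin) =
      (c : ℂ) * ((∫ a, (∫ x, ωinf a Φinf x * conj (Ψinf x) ∂μE) * ainf a ∂μinf) *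
        ∫ b, (∫ y, ((ωfin b Φfin : FinSB F ι) : (ι → FiniteAdeleRing (𝓞 F) F) → ℂ) y *
          conj ((Ψfin : (ι → FiniteAdeleRing (𝓞 F) F) → ℂ) y) ∂μf) * afin b ∂μfin) := by
  simp_rw [schwartzPairing_adelicRep_tmul F ι ωinf ωfin hν]
  rw [← integral_prod_mul, ← integral_const_mul]
  refine integral_congr_ae (Filter.Eventually.of_forall fun g => ?_)
  simp only
  ring

/-! ## §3 The archimedean factor at an `ω_∞`-eigenvector -/

omit [MeasurableSpace (AdeleRing (𝓞 F) F)] [BorelSpace (AdeleRing (𝓞 F) F)] [MeasurableSpace (FiniteAdeleRing (𝓞 F) F)]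
  [BorelSpace (FiniteAdeleRing (𝓞 F) F)] in
/-- **The archimedean local integral at an EIGENVECTOR**: if `ω_∞(a)Φ_∞ = χ_∞(a) Φ_∞` for all `a ∈ G_∞` with `χ_∞`
unitary (`|χ_∞(a)| = 1`), then `∫_{G_∞} ⟨ω_∞(a)Φ_∞, Ψ_∞⟩_∞ \overline{χ_∞(a)} dμ_∞(a) = μ_∞(G_∞) · ⟨Φ_∞, Ψ_∞⟩_∞` (for any
measure `μ_∞` on `G_∞`; `μ_∞.real univ = 0` if it is infinite).  At the archimedean places of [Liu2021, Lem. D.2 (2)] the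
harmonic vector is such an eigenvector of the compact `U(W)(F ⊗ ℝ)`. [cite: Li1992, Thm 2.1 (27) p. 184; §5]
[cite: Liu2021, App. D Lem. D.2 (2)] -/
theorem integral_archCoeff_mul_conj_of_eigen [MeasurableSpace Ginf] (μinf : Measure Ginf)
    {Φinf : 𝓢((ι → mixedSpace F), ℂ)} {χinf : Ginf → ℂ} (hχ : ∀ a, χinf a * conj (χinf a) = 1)
    (heig : ∀ a, ωinf a Φinf = χinf a • Φinf) (Ψinf : 𝓢((ι → mixedSpace F), ℂ)) :
    ∫ a, (∫ x, ωinf a Φinf x * conj (Ψinf x) ∂μE) * conj (χinf a) ∂μinf =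
      (μinf.real Set.univ : ℂ) * ∫ x, Φinf x * conj (Ψinf x) ∂μE := by
  have h : ∀ a, (∫ x, ωinf a Φinf x * conj (Ψinf x) ∂μE) * conj (χinf a) = ∫ x, Φinf x * conj (Ψinf x) ∂μE := by
    intro a
    simp_rw [heig a, smul_apply, smul_eq_mul, mul_assoc]
    rw [integral_const_mul, mul_comm, ← mul_assoc, mul_comm (conj (χinf a)), hχ a, one_mul]
  simp_rw [h]
  rw [integral_const, Complex.real_smul]

/-- **The global Fourier coefficient at an archimedean eigenvector = `c · μ_∞(G_∞) · ⟨Φ_∞, Ψ_∞⟩_∞ ·` the FINITE Fourier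
coefficient**: for `ν_X = c · split_*(μ_∞ ⊗ μ_f)`, `ω = ω_∞ ⊗ ω_f`, `Φ_∞` an `ω_∞`-eigenvector with unitary eigencharacter
`χ_∞`, and any weight `a_f` on `G_f` (e.g. `\overline{χ_f}`):
`∫_{G_∞ × G_f} ⟨ω(g)(Φ_∞ ⊗ Φ_f), Ψ_∞ ⊗ Ψ_f⟩ \overline{χ_∞(g_∞)} a_f(g_f) d(μ_∞ ⊗ μ_f)
  = c · μ_∞(G_∞) · ⟨Φ_∞, Ψ_∞⟩_∞ · ∫_{G_f} ⟨ω_f(b)Φ_f, Ψ_f⟩_f a_f(b) dμ_f(b)`. [cite: Li1992, Thm 2.1 (27) p. 184]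
[cite: Liu2021, proof of Prop. 4.13, l. 2145; App. D Lem. D.2 (2)] -/
theorem integral_coeff_tmul_mul_conj_of_eigen [SFinite μE] [SFinite μf]
    (hν : νX = c • (μE.prod μf).map (piAdeleSplit F ι))
    [MeasurableSpace Ginf] [MeasurableSpace Gfin] (μinf : Measure Ginf) (μfin : Measure Gfin) [SFinite μinf]
    [SFinite μfin] {Φinf : 𝓢((ι → mixedSpace F), ℂ)} {χinf : Ginf → ℂ} (hχ : ∀ a, χinf a * conj (χinf a) = 1)
    (heig : ∀ a, ωinf a Φinf = χinf a • Φinf) (afin : Gfin → ℂ) (Ψinf : 𝓢((ι → mixedSpace F), ℂ))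
    (Φfin Ψfin : FinSB F ι) :
    ∫ g, schwartzPairing F ι νX (adelicRep ωinf ωfin g (piSchwartzBruhatEquiv F ι (Φinf ⊗ₜ Φfin)))
        (piSchwartzBruhatEquiv F ι (Ψinf ⊗ₜ Ψfin)) * (conj (χinf g.1) * afin g.2) ∂(μinf.prod μfin) =
      (c : ℂ) * (μinf.real Set.univ : ℂ) * (∫ x, Φinf x * conj (Ψinf x) ∂μE) *
        ∫ b, (∫ y, ((ωfin b Φfin : FinSB F ι) : (ι → FiniteAdeleRing (𝓞 F) F) → ℂ) y *
          conj ((Ψfin : (ι → FiniteAdeleRing (𝓞 F) F) → ℂ) y) ∂μf) * afin b ∂μfin := by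
  have h := integral_schwartzPairing_adelicRep_tmul_mul F ι ωinf ωfin hν μinf μfin (fun a => conj (χinf a)) afin
    Φinf Ψinf Φfin Ψfin
  rw [h, integral_archCoeff_mul_conj_of_eigen F ι ωinf μinf hχ heig Ψinf]
  ring

/-- **Non-vanishing passes to the finite places**: under the hypotheses of `integral_coeff_tmul_mul_conj_of_eigen` with
`c ≠ 0`, `μ_∞(G_∞) ≠ 0` (finite) and `⟨Φ_∞, Ψ_∞⟩_∞ ≠ 0` (e.g. `Ψ_∞ = Φ_∞ ≠ 0`), the global Fourier coefficient is non-zero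
iff the finite one `∫_{G_f} ⟨ω_f(b)Φ_f, Ψ_f⟩_f a_f(b) dμ_f` is.  This is the reduction of the non-vanishing criterion of
`RallisInnerProductCharacterLift` (polarised form) to the finite places. [cite: Li1992, Thm 2.1 (27) p. 184; §5]
[cite: Liu2021, proof of Prop. 4.13, l. 2145] -/
theorem integral_coeff_tmul_mul_conj_of_eigen_ne_zero_iff [SFinite μE] [SFinite μf]
    (hν : νX = c • (μE.prod μf).map (piAdeleSplit F ι)) (hc : c ≠ 0)
    [MeasurableSpace Ginf] [MeasurableSpace Gfin] (μinf : Measure Ginf) (μfin : Measure Gfin) [IsFiniteMeasure μinf]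
    [SFinite μfin] (hμ : μinf Set.univ ≠ 0) {Φinf : 𝓢((ι → mixedSpace F), ℂ)} {χinf : Ginf → ℂ}
    (hχ : ∀ a, χinf a * conj (χinf a) = 1) (heig : ∀ a, ωinf a Φinf = χinf a • Φinf) (afin : Gfin → ℂ)
    {Ψinf : 𝓢((ι → mixedSpace F), ℂ)} (hΦΨ : ∫ x, Φinf x * conj (Ψinf x) ∂μE ≠ 0) (Φfin Ψfin : FinSB F ι) :
    (∫ g, schwartzPairing F ι νX (adelicRep ωinf ωfin g (piSchwartzBruhatEquiv F ι (Φinf ⊗ₜ Φfin)))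
        (piSchwartzBruhatEquiv F ι (Ψinf ⊗ₜ Ψfin)) * (conj (χinf g.1) * afin g.2) ∂(μinf.prod μfin)) ≠ 0 ↔
      (∫ b, (∫ y, ((ωfin b Φfin : FinSB F ι) : (ι → FiniteAdeleRing (𝓞 F) F) → ℂ) y *
          conj ((Ψfin : (ι → FiniteAdeleRing (𝓞 F) F) → ℂ) y) ∂μf) * afin b ∂μfin) ≠ 0 := by
  rw [integral_coeff_tmul_mul_conj_of_eigen F ι ωinf ωfin hν μinf μfin hχ heig afin Ψinf Φfin Ψfin]
  have h1 : (c : ℂ) ≠ 0 := by exact_mod_cast hc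
  have h2 : (μinf.real Set.univ : ℂ) ≠ 0 :=
    Complex.ofReal_ne_zero.2 (ENNReal.toReal_pos hμ (measure_ne_top μinf _)).ne'
  simp only [ne_eq, mul_eq_zero, h1, h2, hΦΨ, false_or]

end Literature.NumberTheory.Li1992

end
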